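import Mathlib
import Summits.KontsevichZagierPeriods.Zeta5Search.ClassTypeGuardsPeriodicI
import Summits.KontsevichZagierPeriods.Zeta5Search.RayC1GuardsOI
import HarnessLib

/-!
# ζ(5) search — ray C1: PERIODIC TYPING of residue classes (fam-denom g14, staged)

HONEST FRAMING: systematic search; no irrationality claim unless certified.  Integer bookkeeping of net exponents on the ray
`b(n) = n·(85; 35,32,30,27,25,22,20)` (`T1Rays.bRay β1 n`); nothing here is about `ζ(5)`.

The 16 level regions of ray C1 (`RayC1Levels.ne1_*`) restated with DOUBLED bounds `lo ≤ 2q`, `2q + 2 ≤ hi` (so that the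
half-integral centre `85n/2` is a bound like any other), in the shape consumed by `ClassTypeCover.levels_run`; and the typing
theorems `ray1TypeP_ne / ray1TypeP_eq` for a class whose type is a RUN WORD `rdecode R t` (`ClassTypeGuardsPeriodic`), with the
window hypotheses linear in `p` and `P = t·p`.  With these, ONE certificate per Farey cell of `y = n/p − m` and parity class
types every residue class for ALL `m = b₁ + 2t` at once (the guard checks transfer by `check*_pdec`).
-/

open Finset

namespace Summit.KontsevichZagierPeriods.Zeta5Search.ClassTypeCover

open Summit.KontsevichZagierPeriods.Zeta5Search.ClusterValuation
open Summit.KontsevichZagierPeriods.Zeta5Search.T1Rays (bRay β1)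

section Regions

variable (n : ℕ)

/-- Level region below the first block end (`2q + 2 ≤ 40n`): net exponent `1`. -/
theorem reg1_low : ∀ q, 0 ≤ 2 * q → 2 * q + 2 ≤ 40 * n → netExp (bRay β1 n) q = 1 :=
  fun _ _ h => ne1_low (by omega)

/-- Level region `[20n, 22n)` (doubled bounds): net exponent `0`. -/
theorem reg1_d1 : ∀ q, 40 * n ≤ 2 * q → 2 * q + 2 ≤ 44 * n → netExp (bRay β1 n) q = 0 :=
  fun _ h h' => ne1_d1 ⟨by omega, by omega⟩

/-- Level region `[22n, 25n)` (doubled bounds): net exponent `-1`. -/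
theorem reg1_d2 : ∀ q, 44 * n ≤ 2 * q → 2 * q + 2 ≤ 50 * n → netExp (bRay β1 n) q = -1 :=
  fun _ h h' => ne1_d2 ⟨by omega, by omega⟩

/-- Level region `[25n, 27n)` (doubled bounds): net exponent `-2`. -/
theorem reg1_d3 : ∀ q, 50 * n ≤ 2 * q → 2 * q + 2 ≤ 54 * n → netExp (bRay β1 n) q = -2 :=
  fun _ h h' => ne1_d3 ⟨by omega, by omega⟩

/-- Level region `[27n, 30n)` (doubled bounds): net exponent `-3`. -/
theorem reg1_d4 : ∀ q, 54 * n ≤ 2 * q → 2 * q + 2 ≤ 60 * n → netExp (bRay β1 n) q = -3 :=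
  fun _ h h' => ne1_d4 ⟨by omega, by omega⟩

/-- Level region `[30n, 32n)` (doubled bounds): net exponent `-4`. -/
theorem reg1_d5 : ∀ q, 60 * n ≤ 2 * q → 2 * q + 2 ≤ 64 * n → netExp (bRay β1 n) q = -4 :=
  fun _ h h' => ne1_d5 ⟨by omega, by omega⟩

/-- Level region `[32n, 35n)` (doubled bounds): net exponent `-5`. -/
theorem reg1_d6 : ∀ q, 64 * n ≤ 2 * q → 2 * q + 2 ≤ 70 * n → netExp (bRay β1 n) q = -5 :=
  fun _ h h' => ne1_d6 ⟨by omega, by omega⟩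

/-- The well left of the centre. -/
theorem reg1_wl : ∀ q, 70 * n ≤ 2 * q → 2 * q + 2 ≤ 85 * n + 1 → netExp (bRay β1 n) q = -6 :=
  fun _ h h' => ne1_well ⟨by omega, by omega, by omega⟩

/-- The centre. -/
theorem reg1_cen : ∀ q, 85 * n ≤ 2 * q → 2 * q + 2 ≤ 85 * n + 2 → netExp (bRay β1 n) q = -5 :=
  fun _ h h' => ne1_cen (by omega)

/-- The well right of the centre. -/
theorem reg1_wr : ∀ q, 85 * n + 1 ≤ 2 * q → 2 * q + 2 ≤ 100 * n + 2 → netExp (bRay β1 n) q = -6 :=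
  fun _ h h' => ne1_well ⟨by omega, by omega, by omega⟩

/-- The whole well, `n` odd (no centre point). -/
theorem reg1_wo (hn : n % 2 = 1) : ∀ q, 70 * n ≤ 2 * q → 2 * q + 2 ≤ 100 * n + 2 → netExp (bRay β1 n) q = -6 :=
  fun _ h h' => ne1_well ⟨by omega, by omega, by omega⟩

/-- Mirror level region `(50n, 53n]` (doubled bounds): net exponent `-5`. -/
theorem reg1_u6 : ∀ q, 100 * n + 2 ≤ 2 * q → 2 * q + 2 ≤ 106 * n + 2 → netExp (bRay β1 n) q = -5 :=
  fun _ h h' => ne1_u6 ⟨by omega, by omega⟩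

/-- Mirror level region `(53n, 55n]` (doubled bounds): net exponent `-4`. -/
theorem reg1_u5 : ∀ q, 106 * n + 2 ≤ 2 * q → 2 * q + 2 ≤ 110 * n + 2 → netExp (bRay β1 n) q = -4 :=
  fun _ h h' => ne1_u5 ⟨by omega, by omega⟩

/-- Mirror level region `(55n, 58n]` (doubled bounds): net exponent `-3`. -/
theorem reg1_u4 : ∀ q, 110 * n + 2 ≤ 2 * q → 2 * q + 2 ≤ 116 * n + 2 → netExp (bRay β1 n) q = -3 :=
  fun _ h h' => ne1_u4 ⟨by omega, by omega⟩

/-- Mirror level region `(58n, 60n]` (doubled bounds): net exponent `-2`. -/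
theorem reg1_u3 : ∀ q, 116 * n + 2 ≤ 2 * q → 2 * q + 2 ≤ 120 * n + 2 → netExp (bRay β1 n) q = -2 :=
  fun _ h h' => ne1_u3 ⟨by omega, by omega⟩

/-- Mirror level region `(60n, 63n]` (doubled bounds): net exponent `-1`. -/
theorem reg1_u2 : ∀ q, 120 * n + 2 ≤ 2 * q → 2 * q + 2 ≤ 126 * n + 2 → netExp (bRay β1 n) q = -1 :=
  fun _ h h' => ne1_u2 ⟨by omega, by omega⟩

/-- Mirror level region `(63n, 65n]` (doubled bounds): net exponent `0`. -/
theorem reg1_u1 : ∀ q, 126 * n + 2 ≤ 2 * q → 2 * q + 2 ≤ 130 * n + 2 → netExp (bRay β1 n) q = 0 :=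
  fun _ h h' => ne1_u1 ⟨by omega, by omega⟩

/-- Above the blocks (the upper bound is vacuous bookkeeping for `levels_run`). -/
theorem reg1_high : ∀ q, 130 * n + 2 ≤ 2 * q → 2 * q + 2 ≤ 170 * n + 2 → netExp (bRay β1 n) q = 1 :=
  fun _ h _ => ne1_high (by omega)

end Regions

variable {n p x t P : ℕ} [Fact p.Prime]

/-- **PERIODIC TYPING, not self-conjugate**: the class of `x` has type `rdecode R t`, with the window facts linear in `p`, `P = t·p`. -/
theorem ray1TypeP_ne (hP : t * p = P) (R : List Run) (L0 S0 : ℕ) (hlen : rlen0 R = L0 + 1 ∧ rlslope R = S0) (hx : x < p)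
    (hL : x + L0 * p + S0 * P ≤ 85 * n) (hL' : 85 * n < x + L0 * p + S0 * P + p) (hlev : Levels (bRay β1 n) x p (rdecode R t))
    (hne : 2 * x + L0 * p + S0 * P ≠ 85 * n) : IsType (bRay β1 n) p x (rdecode R t) false := by
  have e : (L0 + S0 * t) * p = L0 * p + S0 * P := by rw [← hP]; ring
  refine ray1Type_ne (L0 + S0 * t) (by rw [rdecode_length, hlen.1, hlen.2]; ring) hx ?_ ?_ hlev ?_
  · rw [e]; omega
  · rw [e]; omega
  · rw [show 2 * x + (L0 + S0 * t) * p = 2 * x + (L0 * p + S0 * P) by rw [e]]; omega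

/-- **PERIODIC TYPING, self-conjugate**. -/
theorem ray1TypeP_eq (hP : t * p = P) (R : List Run) (L0 S0 : ℕ) (hlen : rlen0 R = L0 + 1 ∧ rlslope R = S0) (hx : x < p)
    (hL : x + L0 * p + S0 * P ≤ 85 * n) (hL' : 85 * n < x + L0 * p + S0 * P + p) (hlev : Levels (bRay β1 n) x p (rdecode R t))
    (heq : 2 * x + L0 * p + S0 * P = 85 * n) : IsType (bRay β1 n) p x (rdecode R t) true := by
  have e : (L0 + S0 * t) * p = L0 * p + S0 * P := by rw [← hP]; ring
  refine ray1Type_eq (L0 + S0 * t) (by rw [rdecode_length, hlen.1, hlen.2]; ring) hx ?_ ?_ hlev ?_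
  · rw [e]; omega
  · rw [e]; omega
  · rw [show 2 * x + (L0 + S0 * t) * p = 2 * x + (L0 * p + S0 * P) by rw [e]]; omega

end Summit.KontsevichZagierPeriods.Zeta5Search.ClassTypeCover
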